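import Summits.Ventures.PercRepro.DFSTree

/-!
# The DFS decision tree is good

The invariant `Inv` of `DFSTree.lean` through one query (closed, open to an explored vertex,
open to a new vertex — push, or a pop), and the main induction `dfs_good`: if every configuration
of the cylinder satisfies the invariant, the DFS tree decides `reachEvent a T` and every
configuration of the cylinder ends in a `LeafState` for the queried set of its run
(`Good`).  `dfs_good_univ` is the statement for the DFS started at `a ∉ T` with every edge
unqueried: the tree used in Gladkov's proof of Theorem 6.2 (arXiv:2408.08457 §6.2).
-/

namespace PercRepro

namespace MultiGraph

variable {V E : Type*} [DecidableEq V] [DecidableEq E] {G : MultiGraph V E}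

/-! ### The invariant through one query -/

omit [DecidableEq V] in
/-- A closed query, or an open query to an explored vertex, keeps the invariant. -/
theorem Inv.erase_of_explored {T : Finset V} {a : V} {U : Finset E} {top : V} {L : List (E × V)}
    {Q : Finset V} {ω : Config E} (hinv : G.Inv T a U top L Q ω) {e : E}
    (hends : ω e = true → G.fst e ∈ explored top L Q ∧ G.snd e ∈ explored top L Q) :
    G.Inv T a (U.erase e) top L Q ω where
  path := hinv.path
  pathNotU := fun x hx h => hinv.pathNotU x hx (Finset.mem_of_mem_erase h)
  nodup := hinv.nodup
  explQ := fun q hq e' he' => hinv.explQ q hq e' (Finset.mem_of_mem_erase he')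
  openIn := by
    intro e' he' hopen
    by_cases hee : e' = e
    · rw [hee] at hopen ⊢; exact hends hopen
    · exact hinv.openIn e' (fun h => he' (Finset.mem_erase.mpr ⟨hee, h⟩)) hopen
  noT := hinv.noT

/-- An open query to a new vertex outside the targets: push it. -/
theorem Inv.push {T : Finset V} {a : V} {U : Finset E} {top : V} {L : List (E × V)}
    {Q : Finset V} {ω : Config E} (hinv : G.Inv T a U top L Q ω) {e : E} (heU : e ∈ U)
    (hat : G.fst e = top ∨ G.snd e = top) (hopen : ω e = true) (hT : G.other e top ∉ T) :
    G.Inv T a (U.erase e) (G.other e top) ((e, top) :: L) Q ω where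
  path := by
    refine ⟨hopen, ?_, hinv.path⟩
    rcases ends_other (G := G) hat with ⟨h1, h2⟩ | ⟨h1, h2⟩
    · exact Or.inr ⟨h1, h2⟩
    · exact Or.inl ⟨h1, h2⟩
  pathNotU := by
    intro x hx h
    rcases List.mem_cons.mp hx with rfl | hx
    · exact Finset.notMem_erase _ _ h
    · exact hinv.pathNotU x hx (Finset.mem_of_mem_erase h)
  nodup := by
    rw [List.map_cons, List.nodup_cons]
    refine ⟨fun hmem => ?_, hinv.nodup⟩
    obtain ⟨x, hx, hxe⟩ := List.mem_map.mp hmem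
    exact hinv.pathNotU x hx (hxe ▸ heU)
  explQ := fun q hq e' he' => hinv.explQ q hq e' (Finset.mem_of_mem_erase he')
  openIn := by
    intro e' he' hopen'
    have hsub : ∀ x, x ∈ explored top L Q → x ∈ explored (G.other e top) ((e, top) :: L) Q := by
      intro x hx
      rw [mem_explored] at hx ⊢
      rw [List.map_cons, List.mem_cons]
      tauto
    by_cases hee : e' = e
    · rw [hee]
      have hends := ends_other (G := G) hat
      constructor
      · rcases hends with ⟨h1, _⟩ | ⟨h1, _⟩
        · rw [h1]; exact hsub top (Or.inl rfl)
        · rw [h1]; exact Or.inl rfl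
      · rcases hends with ⟨_, h2⟩ | ⟨_, h2⟩
        · rw [h2]; exact Or.inl rfl
        · rw [h2]; exact hsub top (Or.inl rfl)
    · have := hinv.openIn e' (fun h => he' (Finset.mem_erase.mpr ⟨hee, h⟩)) hopen'
      exact ⟨hsub _ this.1, hsub _ this.2⟩
  noT := by
    intro t ht hmem
    rw [mem_explored, List.map_cons, List.mem_cons] at hmem
    simp only at hmem
    rcases hmem with h1 | (h1 | h1) | h1
    · exact hT (h1 ▸ ht)
    · exact hinv.noT t ht (Or.inl h1)
    · exact hinv.noT t ht (Or.inr (Or.inl h1))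
    · exact hinv.noT t ht (Or.inr (Or.inr h1))

omit [DecidableEq E] in
/-- Popping a fully explored vertex keeps the invariant. -/
theorem Inv.pop {T : Finset V} {a : V} {U : Finset E} {top : V} {e : E} {w : V}
    {L : List (E × V)} {Q : Finset V} {ω : Config E}
    (hinv : G.Inv T a U top ((e, w) :: L) Q ω) (hno : ¬ (G.edgesAtV U top).Nonempty) :
    G.Inv T a U w L (insert top Q) ω where
  path := hinv.path.2.2
  pathNotU := fun x hx => hinv.pathNotU x (List.mem_cons_of_mem _ hx)
  nodup := (List.nodup_cons.mp hinv.nodup).2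
  explQ := by
    intro q hq e' he'
    rcases Finset.mem_insert.mp hq with rfl | hq
    · by_contra hc
      apply hno
      refine ⟨e', mem_edgesAtV.mpr ⟨he', ?_⟩⟩
      by_contra hc'
      exact hc ⟨fun h => hc' (Or.inl h), fun h => hc' (Or.inr h)⟩
    · exact hinv.explQ q hq e' he'
  openIn := by
    have hset : ∀ x, x ∈ explored top ((e, w) :: L) Q ↔ x ∈ explored w L (insert top Q) := by
      intro x
      rw [mem_explored, mem_explored, List.map_cons, List.mem_cons, Finset.mem_insert]
      tauto
    intro e' he' hopen
    have := hinv.openIn e' he' hopen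
    exact ⟨(hset _).mp this.1, (hset _).mp this.2⟩
  noT := by
    intro t ht hmem
    apply hinv.noT t ht
    rw [mem_explored, List.map_cons, List.mem_cons]
    rw [mem_explored, Finset.mem_insert] at hmem
    tauto

/-! ### Unfolding the stop result -/

/-- `dfsStop` at a node. -/
theorem dfsStop_node {T : Finset V} {U : Finset E} {top : V} {L : List (E × V)} {Q : Finset V}
    (h : (G.edgesAtV U top).Nonempty) (ω : Config E) :
    G.dfsStop T U top L Q ω =
      if ω h.choose then
        if G.other h.choose top ∈ T then some (G.other h.choose top)
        else if G.other h.choose top = top ∨ G.other h.choose top ∈ L.map Prod.snd ∨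
            G.other h.choose top ∈ Q then
          G.dfsStop T (U.erase h.choose) top L Q ω
        else G.dfsStop T (U.erase h.choose) (G.other h.choose top) ((h.choose, top) :: L) Q ω
      else G.dfsStop T (U.erase h.choose) top L Q ω := by
  cases L with
  | nil => rw [dfsStop.eq_1 G T U top, dif_pos h]
  | cons y L =>
    obtain ⟨e, w⟩ := y
    rw [dfsStop.eq_2 G T U top, dif_pos h]

/-- `dfsStop` at a pop. -/
theorem dfsStop_pop {T : Finset V} {U : Finset E} {top : V} {e : E} {w : V} {L : List (E × V)}
    {Q : Finset V} (h : ¬ (G.edgesAtV U top).Nonempty) (ω : Config E) :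
    G.dfsStop T U top ((e, w) :: L) Q ω = G.dfsStop T U w L (insert top Q) ω := by
  rw [dfsStop.eq_2 G T U top, dif_neg h]

/-- `dfsStop` at an exhausted cluster. -/
theorem dfsStop_exhausted {T : Finset V} {U : Finset E} {top : V} {Q : Finset V}
    (h : ¬ (G.edgesAtV U top).Nonempty) (ω : Config E) :
    G.dfsStop T U top [] Q ω = none := by
  rw [dfsStop.eq_1 G T U top, dif_neg h]

/-! ### The main induction -/

/-- **The DFS is good**: if every configuration of the cylinder satisfies the invariant and the
current state is the state the reference DFS reaches on it, the tree decides `reachEvent a T`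
and the stop events, and every configuration of the cylinder ends in a leaf state for the
queried set of its run and its stop result. -/
theorem dfs_good (T : Finset V) (a : V) (U₀ : Finset E) (top₀ : V) (L₀ : List (E × V))
    (Q₀ : Finset V) : ∀ (U : Finset E) (L : List (E × V)) (top : V)
    (Q : Finset V) (Qs : Set E) (v : E → Bool), (∀ e, e ∈ U ↔ e ∉ Qs) →
    (∀ ω : Config E, (∀ e ∈ Qs, ω e = v e) → G.Inv T a U top L Q ω) →
    (∀ ω : Config E, (∀ e ∈ Qs, ω e = v e) →
      G.dfsStop T U₀ top₀ L₀ Q₀ ω = G.dfsStop T U top L Q ω) →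
    G.Good T a U₀ top₀ L₀ Q₀ (G.dfs T U top L Q) Qs v := by
  intro U
  induction U using Finset.strongInduction with
  | H U ih =>
    -- the node step, shared by both stack shapes
    have step : ∀ (L : List (E × V)) (top : V) (Q : Finset V) (Qs : Set E) (v : E → Bool),
        (∀ e, e ∈ U ↔ e ∉ Qs) →
        (∀ ω : Config E, (∀ e ∈ Qs, ω e = v e) → G.Inv T a U top L Q ω) →
        (∀ ω : Config E, (∀ e ∈ Qs, ω e = v e) →
          G.dfsStop T U₀ top₀ L₀ Q₀ ω = G.dfsStop T U top L Q ω) →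
        (h : (G.edgesAtV U top).Nonempty) →
        G.Good T a U₀ top₀ L₀ Q₀ (DTree.node h.choose true fun b _ =>
          if b then
            if G.other h.choose top ∈ T then DTree.leaf
            else if G.other h.choose top = top ∨ G.other h.choose top ∈ L.map Prod.snd ∨
                G.other h.choose top ∈ Q then
              G.dfs T (U.erase h.choose) top L Q
            else G.dfs T (U.erase h.choose) (G.other h.choose top) ((h.choose, top) :: L) Q
          else G.dfs T (U.erase h.choose) top L Q) Qs v := by
      intro L top Q Qs v hUQ hinv hstate h
      set e := h.choose with he_def
      have he : e ∈ U ∧ (G.fst e = top ∨ G.snd e = top) := mem_edgesAtV.mp h.choose_spec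
      have hst : ∀ ω : Config E, G.dfsStop T U top L Q ω =
          if ω e then
            if G.other e top ∈ T then some (G.other e top)
            else if G.other e top = top ∨ G.other e top ∈ L.map Prod.snd ∨ G.other e top ∈ Q then
              G.dfsStop T (U.erase e) top L Q ω
            else G.dfsStop T (U.erase e) (G.other e top) ((e, top) :: L) Q ω
          else G.dfsStop T (U.erase e) top L Q ω := fun ω => dfsStop_node h ω
      have hsub := Finset.erase_ssubset he.1
      have heQs : e ∉ Qs := (hUQ e).mp he.1
      have hUQ' : ∀ e', e' ∈ U.erase e ↔ e' ∉ insert e Qs := by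
        intro e'
        rw [Finset.mem_erase, hUQ e', Set.mem_insert_iff]
        tauto
      -- the cylinder of a continuation lies in the cylinder of the node, with `e` revealed
      have hcyl : ∀ (b : Bool) (ω : Config E), (∀ e' ∈ insert e Qs, ω e' = Function.update v e b e') →
          (∀ e' ∈ Qs, ω e' = v e') ∧ ω e = b := by
        intro b ω hω
        refine ⟨fun e' he' => ?_, ?_⟩
        · have hne : e' ≠ e := fun h' => heQs (h' ▸ he')
          have := hω e' (Set.mem_insert_of_mem _ he')
          rwa [Function.update_of_ne hne] at this
        · have := hω e (Set.mem_insert e Qs)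
          rwa [Function.update_self] at this
      refine good_node fun b b' => ?_
      cases b with
      | false =>
        simp only [Bool.false_eq_true, if_false]
        refine ih _ hsub _ _ _ _ _ hUQ' (fun ω hω => ?_) fun ω hω => ?_
        · obtain ⟨hω', hωe⟩ := hcyl false ω hω
          exact (hinv ω hω').erase_of_explored fun h' => absurd (hωe.symm.trans h') (by decide)
        · obtain ⟨hω', hωe⟩ := hcyl false ω hω
          rw [hstate ω hω', hst ω, hωe]
          simp only [Bool.false_eq_true, if_false]
      | true =>
        simp only [if_true]
        split_ifs with hT hseen
        · -- STOP: the leaf decides `reachEvent` (true) and is a stop state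
          have hreach : ∀ ω : Config E, (∀ e' ∈ insert e Qs, ω e' = Function.update v e true e') →
              ω ∈ G.reachEvent a T := by
            intro ω hω
            obtain ⟨hω', hωe⟩ := hcyl true ω hω
            have hpath := (hinv ω hω').path.conn
            refine ⟨G.other e top, hT, hpath.symm.trans (Conn.of_openAdj ⟨e, hωe, ?_⟩)⟩
            exact ends_other (G := G) he.2
          have hval : ∀ ω : Config E, (∀ e' ∈ insert e Qs, ω e' = Function.update v e true e') →
              G.dfsStop T U₀ top₀ L₀ Q₀ ω = some (G.other e top) := by
            intro ω hω
            obtain ⟨hω', hωe⟩ := hcyl true ω hω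
            rw [hstate ω hω', hst ω, hωe]
            simp only [if_true, if_pos hT]
          refine good_leaf (fun ω ζ hω hζ => ⟨fun _ => hreach ζ hζ, fun _ => hreach ω hω⟩)
            (fun u ω ζ hω hζ => by simp only [stopEvent, Set.mem_setOf_eq, hval ω hω, hval ζ hζ])
            fun ω hω => Or.inl ⟨top, L, Q, e, G.other e top, hval ω hω, hT, Set.mem_insert e Qs,
              ?_, ?_, ?_, ?_, ?_, ?_, ?_, ?_, ?_⟩
          all_goals obtain ⟨hω', hωe⟩ := hcyl true ω hω
          all_goals have hI := hinv ω hω'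
          · exact hωe
          · exact ends_other (G := G) he.2
          · intro hmem
            obtain ⟨x, hx, hxe⟩ := List.mem_map.mp hmem
            exact hI.pathNotU x hx (hxe ▸ he.1)
          · exact hI.path
          · intro x hx
            refine Set.mem_insert_of_mem _ ?_
            by_contra hc
            exact hI.pathNotU x hx ((hUQ x.1).mpr hc)
          · exact hI.nodup
          · intro q hq e' he'
            refine Set.mem_insert_of_mem _ ?_
            by_contra hc
            have he'U : e' ∈ U := (hUQ e').mpr hc
            have := hI.explQ q hq e' he'U
            rcases he' with h' | h'
            · exact this.1 h'
            · exact this.2 h'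
          · intro e' he' hne hopen
            have he'Qs : e' ∈ Qs := (Set.mem_insert_iff.mp he').resolve_left hne
            exact hI.openIn e' (fun h' => (hUQ e').mp h' he'Qs) hopen
          · exact hI.noT
        · -- an explored vertex: continue at `top`
          refine ih _ hsub _ _ _ _ _ hUQ' (fun ω hω => ?_) fun ω hω => ?_
          swap
          · obtain ⟨hω', hωe⟩ := hcyl true ω hω
            rw [hstate ω hω', hst ω, hωe]
            simp only [if_true, if_neg hT, if_pos hseen]
          obtain ⟨hω', hωe⟩ := hcyl true ω hω
          refine (hinv ω hω').erase_of_explored fun _ => ?_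
          have hends := ends_other (G := G) he.2
          have hoth : G.other e top ∈ explored top L Q := by
            rw [mem_explored]; exact hseen
          constructor
          · rcases hends with ⟨h1, _⟩ | ⟨h1, _⟩
            · rw [h1]; exact Or.inl rfl
            · rw [h1]; exact hoth
          · rcases hends with ⟨_, h2⟩ | ⟨_, h2⟩
            · rw [h2]; exact hoth
            · rw [h2]; exact Or.inl rfl
        · -- a new vertex: push it
          refine ih _ hsub _ _ _ _ _ hUQ' (fun ω hω => ?_) fun ω hω => ?_
          · obtain ⟨hω', hωe⟩ := hcyl true ω hω
            exact (hinv ω hω').push he.1 he.2 hωe hT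
          · obtain ⟨hω', hωe⟩ := hcyl true ω hω
            rw [hstate ω hω', hst ω, hωe]
            simp only [if_true, if_neg hT, if_neg hseen]
    intro L
    induction L with
    | nil =>
      intro top Q Qs v hUQ hinv hstate
      by_cases h : (G.edgesAtV U top).Nonempty
      · rw [dfs, dif_pos h]
        exact step [] top Q Qs v hUQ hinv hstate h
      · rw [dfs, dif_neg h]
        -- EXHAUSTED: `top = a`, the cluster of `a` is the popped set plus `a`
        have hno : ∀ e ∈ U, G.fst e ≠ top ∧ G.snd e ≠ top := by
          intro e he
          by_contra hc
          apply h
          refine ⟨e, mem_edgesAtV.mpr ⟨he, ?_⟩⟩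
          by_contra hc'
          exact hc ⟨fun h' => hc' (Or.inl h'), fun h' => hc' (Or.inr h')⟩
        have hnot : ∀ ω : Config E, (∀ e ∈ Qs, ω e = v e) → ω ∉ G.reachEvent a T := by
          intro ω hω hreach
          obtain ⟨t, ht, hconn⟩ := hreach
          have hI := hinv ω hω
          have htop : top = a := hI.path
          subst htop
          have hX : ∀ e, ω e = true →
              (G.fst e ∈ explored top ([] : List (E × V)) Q ↔ G.snd e ∈ explored top ([] : List (E × V)) Q) := by
            intro e hopen
            by_cases heU : e ∈ U
            · have h1 := hno e heU
              have h2 := hI.explQ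
              constructor
              · intro hmem
                rw [mem_explored] at hmem
                rcases hmem with h' | h' | h'
                · exact absurd h' h1.1
                · simp at h'
                · exact absurd rfl (h2 _ h' e heU).1
              · intro hmem
                rw [mem_explored] at hmem
                rcases hmem with h' | h' | h'
                · exact absurd h' h1.2
                · simp at h'
                · exact absurd rfl (h2 _ h' e heU).2
            · have := hI.openIn e heU hopen
              exact ⟨fun _ => this.2, fun _ => this.1⟩
          have hmem := mem_of_conn_of_closed_boundary hX (Or.inl rfl) hconn
          exact hI.noT t ht hmem
        have hval : ∀ ω : Config E, (∀ e ∈ Qs, ω e = v e) →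
            G.dfsStop T U₀ top₀ L₀ Q₀ ω = none := by
          intro ω hω
          rw [hstate ω hω, dfsStop_exhausted h]
        refine good_leaf (fun ω ζ hω hζ => ⟨fun h' => absurd h' (hnot ω hω), fun h' => absurd h' (hnot ζ hζ)⟩)
          (fun u ω ζ hω hζ => by simp only [stopEvent, Set.mem_setOf_eq, hval ω hω, hval ζ hζ])
          fun ω hω => ?_
        have hI := hinv ω hω
        have htop : top = a := hI.path
        subst htop
        refine Or.inr ⟨hval ω hω, insert top Q, Finset.mem_insert_self _ _, ?_, ?_, ?_⟩
        · intro q hq e' he'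
          by_contra hc
          have he'U : e' ∈ U := (hUQ e').mpr hc
          rcases Finset.mem_insert.mp hq with rfl | hq
          · have := hno e' he'U
            rcases he' with h' | h'
            · exact this.1 h'
            · exact this.2 h'
          · have := hI.explQ q hq e' he'U
            rcases he' with h' | h'
            · exact this.1 h'
            · exact this.2 h'
        · intro e' he' hopen
          have := hI.openIn e' (fun h' => (hUQ e').mp h' he') hopen
          simp only [mem_explored, List.map_nil, List.not_mem_nil, false_or] at this
          rw [Finset.mem_insert, Finset.mem_insert]
          exact this
        · intro t ht hmem
          apply hI.noT t ht
          rw [mem_explored]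
          rcases Finset.mem_insert.mp hmem with rfl | hmem
          · exact Or.inl rfl
          · exact Or.inr (Or.inr hmem)
    | cons y L ihL =>
      intro top Q Qs v hUQ hinv hstate
      obtain ⟨e, w⟩ := y
      by_cases h : (G.edgesAtV U top).Nonempty
      · rw [dfs, dif_pos h]
        exact step ((e, w) :: L) top Q Qs v hUQ hinv hstate h
      · rw [dfs, dif_neg h]
        exact ihL w (insert top Q) Qs v hUQ (fun ω hω => (hinv ω hω).pop h)
          fun ω hω => by rw [hstate ω hω, dfsStop_pop h]

/-- **The DFS from `a`** (all edges unqueried, empty stack) is good when `a` is not a target. -/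
theorem dfs_good_univ [Fintype E] (T : Finset V) {a : V} (haT : a ∉ T) :
    G.Good T a Finset.univ a [] ∅ (G.dfs T Finset.univ a [] ∅) ∅ (fun _ => false) := by
  refine dfs_good T a _ _ _ _ _ _ _ _ _ _ (fun e => by simp) (fun ω _ => ?_) fun ω _ => rfl
  exact {
    path := rfl
    pathNotU := fun x hx => by simp at hx
    nodup := List.nodup_nil
    explQ := fun q hq => by simp at hq
    openIn := fun e he => absurd (Finset.mem_univ e) he
    noT := fun t ht hmem => by
      rw [mem_explored] at hmem
      simp only [List.map_nil, List.not_mem_nil, Finset.notMem_empty, or_false] at hmem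
      exact haT (hmem ▸ ht) }

end MultiGraph

end PercRepro
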